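import Literature.Probability.LatticeModels.GibbsSpecificationProofs
import HarnessLib

/-!
# Successive conditioning on nested volumes for the finite-volume Ising measures

Topic `Literature/Probability/LatticeModels`. The "multiplication of conditional bounds over
scales" used in multi-scale arguments for the Ising model (Kemppainen–Smirnov, Ann. Probab. 45
(2017), proof of Prop. 3.5 / p. 11 of arXiv:1212.6215: "using this in several concentric annuli
we get … for a larger annulus"; Duminil-Copin–Smirnov 2012, §6.1 eq. (6.2) for the FK model),
derived from the consistency of the Ising kernels (`lintegral_isingMeasure_fixed_consistent`,
Friedli–Velenik 2017, Lemma 6.7):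

* `isingMeasure_fixed_inter_le_mul` — for `Λ ⊆ Λ'`, a measurable event `A` and an event `B`
  *determined by the spins off `Λ`*: if `μ^ζ_{Λ;β,h}(A) ≤ ε` for every boundary condition `ζ`,
  then `μ^η_{Λ';β,h}(A ∩ B) ≤ ε · μ^η_{Λ';β,h}(B)` (conditionally on the outside of `Λ`, `B` is
  decided and `A` costs at most `ε`);
* `isingMeasure_fixed_biInter_le_prod` — for nested volumes `Λ_0 ⊆ Λ_1 ⊆ ⋯ ⊆ Λ_m` and
  measurable events `F_i` with `F_{i+1}` determined by the spins off `Λ_i` and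
  `μ^ζ_{Λ_i}(F_i) ≤ ε_i` for all `ζ`: `μ^η_{Λ_m}(⋂_{i ≤ m} F_i) ≤ ∏_{i ≤ m} ε_i`.

No sign condition on `β`; everything is proved.

## References

* S. Friedli, Y. Velenik, *Statistical Mechanics of Lattice Systems* (2017), Lemma 6.7 —
  `FriedliVelenik2017`.
* A. Kemppainen, S. Smirnov, Ann. Probab. 45 (2017) (arXiv:1212.6215, p. 11) — `KemppainenSmirnov2017`.
* H.-O. Georgii, *Gibbs Measures and Phase Transitions* (2011), Def. 1.23 — `Georgii2011`.
-/

noncomputable section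

namespace Literature.Probability.LatticeModels

open MeasureTheory Finset
open scoped ENNReal

variable {V : Type*} (G : SimpleGraph V) [DecidableEq V] [G.LocallyFinite]

/-- **An event determined off the volume is decided by the boundary condition**: if `B` only
depends on the spins off `Λ`, then `μ^ζ_{Λ;β,h}(A ∩ B) = 1_B(ζ) · μ^ζ_{Λ;β,h}(A)` (the measure is
carried by the configurations glued into `ζ`). [cite: FriedliVelenik2017, §6.2, Lemma 6.7] -/
theorem isingMeasure_fixed_inter_of_determined_off (Λ : Finset V) (β h : ℝ) (ζ : SpinConfig V)
    {A B : Set (SpinConfig V)} (hA : MeasurableSet A) (hB : MeasurableSet B)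
    (hBdet : ∀ σ₁ σ₂ : SpinConfig V, (∀ x ∉ Λ, σ₁ x = σ₂ x) → (σ₁ ∈ B ↔ σ₂ ∈ B)) :
    isingMeasure G Λ β h (.fixed ζ) (A ∩ B) =
      B.indicator (fun _ ↦ isingMeasure G Λ β h (.fixed ζ) A) ζ := by
  classical
  have hglue : ∀ τ : Λ → ℤˣ, glue Λ τ (.fixed ζ) ∈ B ↔ ζ ∈ B := fun τ ↦
    hBdet _ _ fun x hx ↦ by rw [glue_apply_of_notMem _ _ _ hx, BoundaryCondition.outside_fixed]
  rw [isingMeasure_apply_of_measurableSet G Λ β h _ (hA.inter hB),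
    isingMeasure_apply_of_measurableSet G Λ β h _ hA]
  by_cases hζ : ζ ∈ B
  · rw [Set.indicator_of_mem hζ]
    congr 2
    refine Finset.sum_congr ?_ fun _ _ ↦ rfl
    ext τ
    simp only [Finset.mem_filter, Finset.mem_univ, true_and, Set.mem_inter_iff, hglue τ, hζ, and_true]
  · rw [Set.indicator_of_notMem hζ]
    convert ENNReal.ofReal_zero using 2
    rw [Finset.sum_eq_zero fun τ hτ ↦ ?_, zero_div]
    rw [Finset.mem_filter] at hτ
    exact absurd ((hglue τ).1 hτ.2.2) hζ

/-- **One step of successive conditioning** (Kemppainen–Smirnov 2017, proof of Prop. 3.5;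
DCS 2012, (6.2)): for `Λ ⊆ Λ'`, `A` measurable with `μ^ζ_{Λ;β,h}(A) ≤ ε` for every boundary
condition `ζ`, and `B` measurable and determined by the spins off `Λ`,
`μ^η_{Λ';β,h}(A ∩ B) ≤ ε · μ^η_{Λ';β,h}(B)`. From the consistency
`μ^η_{Λ'}(A ∩ B) = ∫ μ^σ_Λ(A ∩ B) dμ^η_{Λ'}(σ) = ∫_B μ^σ_Λ(A) dμ^η_{Λ'}(σ)`.
[cite: KemppainenSmirnov2017, Prop. 3.5 (proof)] -/
theorem isingMeasure_fixed_inter_le_mul {Λ Λ' : Finset V} (hsub : Λ ⊆ Λ') (β h : ℝ) (η : SpinConfig V)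
    {A B : Set (SpinConfig V)} (hA : MeasurableSet A) (hB : MeasurableSet B)
    (hBdet : ∀ σ₁ σ₂ : SpinConfig V, (∀ x ∉ Λ, σ₁ x = σ₂ x) → (σ₁ ∈ B ↔ σ₂ ∈ B))
    {ε : ℝ≥0∞} (hε : ∀ ζ : SpinConfig V, isingMeasure G Λ β h (.fixed ζ) A ≤ ε) :
    isingMeasure G Λ' β h (.fixed η) (A ∩ B) ≤ ε * isingMeasure G Λ' β h (.fixed η) B := by
  rw [← lintegral_isingMeasure_fixed_consistent G hsub β h η (hA.inter hB)]
  simp_rw [isingMeasure_fixed_inter_of_determined_off G Λ β h _ hA hB hBdet]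
  calc ∫⁻ σ, B.indicator (fun _ ↦ isingMeasure G Λ β h (.fixed σ) A) σ ∂isingMeasure G Λ' β h (.fixed η)
      ≤ ∫⁻ σ, B.indicator (fun _ ↦ ε) σ ∂isingMeasure G Λ' β h (.fixed η) := by
        refine lintegral_mono fun σ ↦ ?_
        by_cases hσ : σ ∈ B
        · rw [Set.indicator_of_mem hσ, Set.indicator_of_mem hσ]; exact hε σ
        · rw [Set.indicator_of_notMem hσ, Set.indicator_of_notMem hσ]
    _ = ε * isingMeasure G Λ' β h (.fixed η) B := by
        rw [lintegral_indicator hB, setLIntegral_const, mul_comm]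

/-- **Successive conditioning over nested volumes** (the product of conditional bounds over
scales: Kemppainen–Smirnov 2017, p. 11 of arXiv:1212.6215, "using this in several concentric
annuli we get … for a larger annulus"; DCS 2012, eq. (6.2)). Let `Λ_0 ⊆ Λ_1 ⊆ ⋯` be finite
volumes, `F_i` measurable events such that `F_{i+1}` is determined by the spins off `Λ_i`, and
`μ^ζ_{Λ_i;β,h}(F_i) ≤ ε_i` for every boundary condition `ζ`. Then for every `m` and `η`,
`μ^η_{Λ_m;β,h}(⋂_{i ≤ m} F_i) ≤ ∏_{i ≤ m} ε_i`. [cite: KemppainenSmirnov2017, Prop. 3.5 (proof)] -/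
theorem isingMeasure_fixed_biInter_le_prod (Λs : ℕ → Finset V) (hmono : ∀ i, Λs i ⊆ Λs (i + 1))
    (β h : ℝ) (F : ℕ → Set (SpinConfig V)) (hFm : ∀ i, MeasurableSet (F i))
    (hFdet : ∀ i, ∀ σ₁ σ₂ : SpinConfig V, (∀ x ∉ Λs i, σ₁ x = σ₂ x) → (σ₁ ∈ F (i + 1) ↔ σ₂ ∈ F (i + 1)))
    (ε : ℕ → ℝ≥0∞) (hε : ∀ i (ζ : SpinConfig V), isingMeasure G (Λs i) β h (.fixed ζ) (F i) ≤ ε i)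
    (m : ℕ) (η : SpinConfig V) :
    isingMeasure G (Λs m) β h (.fixed η) (⋂ i ∈ Finset.range (m + 1), F i) ≤ ∏ i ∈ Finset.range (m + 1), ε i := by
  induction m generalizing η with
  | zero => simpa using hε 0 η
  | succ m ih =>
    have hmeas : MeasurableSet (⋂ i ∈ Finset.range (m + 1), F i) :=
      MeasurableSet.biInter (Finset.range (m + 1)).countable_toSet fun i _ ↦ hFm i
    rw [Finset.range_add_one, Finset.set_biInter_insert, Finset.prod_insert Finset.notMem_range_self,
      Set.inter_comm]
    calc isingMeasure G (Λs (m + 1)) β h (.fixed η) ((⋂ i ∈ Finset.range (m + 1), F i) ∩ F (m + 1))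
        ≤ (∏ i ∈ Finset.range (m + 1), ε i) * isingMeasure G (Λs (m + 1)) β h (.fixed η) (F (m + 1)) :=
          isingMeasure_fixed_inter_le_mul G (hmono m) β h η hmeas (hFm (m + 1)) (hFdet m) ih
      _ ≤ (∏ i ∈ Finset.range (m + 1), ε i) * ε (m + 1) := by gcongr; exact hε (m + 1) η
      _ = ε (m + 1) * ∏ i ∈ Finset.range (m + 1), ε i := mul_comm _ _

end Literature.Probability.LatticeModels

end
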